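import Summits.QuantumFields.YangMills.Theorems.FluctuationComparisonRegPrIntLS2BetaOneStepMeanLetter
import Summits.QuantumFields.YangMills.Theorems.UnitScaleTiltProp7AxialGaugeFace
import HarnessLib

/-!
# S2β · `hFlat` road, brick (ii-b)₁ of UV3-NODE §57.8 (D) — STAIRCASE STOKES WITH PLAQUETTE SLOTS, AND THE COMB-FAN BOUND IN SUM CURRENCY

Cell `ym3-torus` (rung R3 = continuum `SU(2)` Yang–Mills on the three-torus — NOT d = 4, NOT infinite volume, NOT a mass gap, NOT Clay).
Width seat «width 13» `ym3-torus-px13` (gen 22), FREE px helper on crux `stmt-QuantumFields-20520` (`Theses.UnitScaleTilt.FluctuationComparisonRegPrIntL`),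
count-neutral, DEFINITION-FREE, any gauge group `[GaugeGroup G]`, any torus `Site P j` of the `Setup` tower.

WHY (UV3-NODE §57.8 (B), requirement (R2)).  The nonlinear assembly of the depth-uniform flat letter `hFlat` is the ℓ² recursion
`B_t ≤ √L·B_{t+1} + R_t`, `R_t = ‖size of the RELATIVE field U′_t·I_t(U′_{t+1})⁻¹‖_{ℓ²}` in the comb axial gauge relative to the lifted background.
The tree HAS the relative axial algebra and its SUP-currency letters (✓`Prop7AxialGaugeSup.mul_inv_eq_conj_of_axial`, ✓`dist1_mul_inv_le_of_axial`
«`≤ |x−y|₁·(δ_W+δ₀)`», ✓`Prop7AxialGaugeFace.holAt_faceWord_of_axial`), all through the sup bound ✓`dist1_holAt_combLoop_le` under `PlaqSmall δ`.  An ℓ²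
recursion needs the right side as a SUM over an explicit, local, configuration-independent family of plaquettes (then Cauchy–Schwarz × a one-level
multiplicity).  This file supplies that currency for the two loops of the letters; the companion `…S2BetaRelativeFieldLetter` assembles the letters.

* §1 words: `seg κ k = axisRun κ k`, `treeWord v = stairRuns v (d−1, …, 0)` (the comb IS a staircase), the split of the processing order at an axis,
  the UNIFORM one-step lemma `𝒰(seg μ (k+1)) = 𝒰(seg μ k)·U⟨end, μ⟩` (both signs), ends as translates, `rowProd_add`.
* §2 ★ `dist1_stairLoop_cons_le` (the induction step of ✓(b3) §3 `dist1_stairLoop_le_sum_rect`, isolated), ★★ `exists_sites_stairLoop_le` — the diagonal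
  staircase loop (staircase, row of `N` steps, translated staircase back, row back) is within `Σ_{κ ∈ axes} Σ_{r<|n_κ|} Σ_{s<N} dist1 U(∂p(site κ r + s e_μ; μ, κ))`
  of `1` for a `U`-INDEPENDENT slot family `site κ r = x + w`, `|w_ι| ≤ |n_ι|` on the listed axes, `0` elsewhere (✓`dist1_rect_le_unoriented` per leg);
  ★ `dist1_combLoop_eq_fanLoop` — the comb loop `Γ_{y,y+v} ∪ [y+v,y+v+e_μ] ∪ (−Γ_{y,y+v+e_μ})` is CONJUGATE to the fan loop over the later axes at the end
  of the `μ`-segment (row length `1`); ★★ `exists_sites_combLoop_le` — THE COMB-FAN STOKES BOUND IN SUM CURRENCY, same left side as the sup edition: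
  `dist1 ≤ Σ_{κ≠μ} Σ_{r<|v_κ|} dist1 U(∂p(site κ r; μ, κ))`, at most `|v|₁` plaquettes inside the box of the comb.

HONEST SCOPE.  Lattice-word and group bookkeeping over landed tree lemmas ([Balaban1985Averaging] (19)–(20): `|XY − 1| ≤ |X − 1| + |Y − 1|`, unitary
invariance); nothing of Bałaban's analysis; `hFlat`, TUBE-REG∘, GAP♯∘ (`stub_uniformFibreGapOrbit`), S2β, crux 20520, `YM3TorusSU2` are NOT proved; no registered
stub is closed; the Yang–Mills mass gap is NOT proved.
References: T. Bałaban, CMP **98** (1985) 17–51 [Balaban1985Averaging] ((9) p.19, (19)–(20) p.21, pp.24–25); CMP **99** (1985) 75–102 [Balaban1985RegularSpaces]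
((1.19), Lemma 1 (1.25)–(1.26) p.79); CMP **109** (1987) 249–301 [Balaban1987RG1] ((0.3)–(0.4) pp.252–253); CMP **95** (1984) 17–40 [Balaban1984PropagatorsI] ((1.7) p.18).
-/

set_option autoImplicit false

namespace Summit.QuantumFields.YangMills.Theorems.FluctuationComparisonRegPrIntLS2BetaStaircaseSlotStokes

open Finset
open Literature.MathematicalPhysics.QuantumFieldTheory.Balaban1983to89
open T4Continuum T4ReflectionCone BlockAveraging
open B10Eq47AxialChi (shiftN shiftN_zero shiftN_succ rowProd rowProd_zero rowProd_succ rect)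
open B10Eq27TorusAxialLog (transl transl_apply transl_add transl_add_e transl_zero)
open B7Prop1Explicit (treeWord seg e e_apply)
open Summit.QuantumFields.YangMills.Theorems.Prop7AxialGaugeSup (seg_natCast_succ seg_neg_succ)
open Summit.QuantumFields.YangMills.Theorems.Prop7FlatHolonomy (holAt_walk_single_true)
open Summit.QuantumFields.YangMills.Theorems.Prop7AxialGaugeFace (netDisp_treeWord)
open Summit.QuantumFields.YangMills.Theorems.FluctuationComparisonRegPrIntLS2BetaRowTransportVariance (dist1_rect_le_unoriented shiftN_add)
open Summit.QuantumFields.YangMills.Theorems.FluctuationComparisonRegPrIntLS2BetaOneStepMeanLetter (walkEnd_shiftN holAt_walk_axisRun_of_nonneg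
  holAt_walk_axisRun_of_neg dist1_oneLeg_fwd dist1_oneLeg_bwd)

/-! ## §1 Words: the comb is a staircase; splitting it at an axis; the uniform one-step lemma -/

section Words

variable {P : Params} {j : ℕ} {G : Type*} [GaugeGroup G]

/-- The straight segment of [Balaban1985Averaging] p. 20 IS the axis run of [Balaban1987RG1] (0.3): `seg κ k = axisRun κ k`. [folklore] -/
theorem seg_eq_axisRun {d : ℕ} (κ : Fin d) (k : ℤ) : seg κ k = axisRun κ k := by
  cases k with
  | ofNat n => simp [seg, axisRun]
  | negSucc n => simp [seg, axisRun]

/-- A staircase word is the concatenation of its runs: `stairRuns n as = as.flatMap (axisRun · (n ·))`. [cite: Balaban1987RG1, (0.3) p.252] -/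
theorem stairRuns_eq_flatMap {d : ℕ} (n : Fin d → ℤ) : ∀ as : List (Fin d), stairRuns n as = as.flatMap fun a => axisRun a (n a)
  | [] => rfl
  | a :: as => by rw [stairRuns, List.flatMap_cons, stairRuns_eq_flatMap n as]

/-- Staircase words only read the offsets of the listed axes. [folklore] -/
theorem stairRuns_congr {d : ℕ} {n n' : Fin d → ℤ} : ∀ {as : List (Fin d)}, (∀ a ∈ as, n a = n' a) → stairRuns n as = stairRuns n' as
  | [], _ => rfl
  | a :: as, h => by
    rw [stairRuns, stairRuns, h a (by simp), stairRuns_congr (as := as) fun b hb => h b (by simp [hb])]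

/-- **THE COMB IS A STAIRCASE**: `Γ_{y,y+v} = treeWord v` is the staircase over the axes in the order `d−1, …, 0`. [cite: Balaban1984PropagatorsI, (1.7) p.18; Balaban1987RG1, (0.3) p.252] -/
theorem treeWord_eq_stairRuns {d : ℕ} (v : Fin d → ℤ) : treeWord v = stairRuns v (List.finRange d).reverse := by
  rw [treeWord, stairRuns_eq_flatMap]
  simp only [seg_eq_axisRun]

/-- Splitting the processing order of the comb at an axis `μ`: `(d−1, …, 0) = s ++ μ :: t` with `μ ∉ s`, `μ ∉ t`, `t` duplicate-free. [folklore] -/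
theorem exists_split_axes {d : ℕ} (μ : Fin d) :
    ∃ s t : List (Fin d), (List.finRange d).reverse = s ++ μ :: t ∧ μ ∉ s ∧ μ ∉ t ∧ s.Nodup ∧ t.Nodup ∧ ∀ a ∈ s, a ∉ t := by
  obtain ⟨s, t, hst⟩ := List.append_of_mem (a := μ) (l := (List.finRange d).reverse) (by simp)
  have hnd : (s ++ μ :: t).Nodup := by
    rw [← hst]; exact List.nodup_reverse.mpr (List.nodup_finRange d)
  have hmid := List.nodup_middle.mp hnd
  have hμst : μ ∉ s ++ t := (List.nodup_cons.mp hmid).1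
  rw [List.mem_append, not_or] at hμst
  have hst' : (s ++ t).Nodup := (List.nodup_cons.mp hmid).2
  rw [List.nodup_append] at hst'
  exact ⟨s, t, hst, hμst.1, hμst.2, hst'.1, hst'.2.1, fun a ha hat => hst'.2.2 a ha a hat rfl⟩

/-- **THE UNIFORM ONE-STEP LEMMA** (both signs of `k`): the segment of `k + 1` steps is, AS A TRANSPORT, the segment of `k` steps followed by the
bond at its end — `𝒰_y(seg μ (k+1)) = 𝒰_y(seg μ k)·U⟨end, μ⟩` and the end moves by `+e_μ` (for `k < 0` the last backward letter is undone).
[cite: Balaban1985Averaging, (9) p.19] -/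
theorem holAt_walk_seg_succ (U : GaugeField P j G) (y : Site P j) (μ : Fin P.d) (k : ℤ) :
    holAt U (walk y (seg μ (k + 1))) = holAt U (walk y (seg μ k)) * U ⟨walkEnd y (seg μ k), μ⟩ ∧
      walkEnd y (seg μ (k + 1)) = (walkEnd y (seg μ k)).shift μ := by
  cases k with
  | ofNat n =>
    have h : seg μ ((Int.ofNat n) + 1) = seg μ (Int.ofNat n) ++ [(μ, true)] := seg_natCast_succ μ n
    rw [h, walk_append, holAt_append, walkEnd_append, holAt_walk_single_true]
    exact ⟨rfl, rfl⟩
  | negSucc n =>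
    -- `seg μ (−(n+1)) = seg μ (−n) ++ [−e_μ]` and `−(n+1) + 1 = −n`
    have hk : Int.negSucc n + 1 = -(n : ℤ) := by rw [Int.negSucc_eq]; ring
    have h : seg μ (Int.negSucc n) = seg μ (-(n : ℤ)) ++ [(μ, false)] := by rw [Int.negSucc_eq]; exact seg_neg_succ μ n
    rw [hk, h, walk_append, holAt_append, walkEnd_append]
    set z := walkEnd y (seg μ (-(n : ℤ)))
    have hw : walk z [(μ, false)] = [⟨⟨z.unshift μ, μ⟩, false⟩] := rfl
    have he : walkEnd z [(μ, false)] = z.unshift μ := rfl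
    rw [hw, he, Site.shift_unshift]
    refine ⟨?_, rfl⟩
    simp [holAt_cons, holAt_nil]

/-- The end of the comb word is the translate: `walkEnd y (treeWord v) = y + v`. [cite: Balaban1984PropagatorsI, (1.7) p.18] -/
theorem walkEnd_treeWord (y : Site P j) (v : Fin P.d → ℤ) : walkEnd y (treeWord v) = transl y v := by
  funext ν
  rw [walkEnd_apply, netDisp_treeWord, transl_apply]

/-- The end of any word is the translate by its net displacement. [folklore] -/
theorem walkEnd_eq_transl (y : Site P j) (w : List (Letter P.d)) : walkEnd y w = transl y (fun ν => netDisp w ν) := by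
  funext ν
  rw [walkEnd_apply, transl_apply]

/-- `shiftN x μ 1 = x + e_μ`. [folklore] -/
theorem shiftN_one (x : Site P j) (μ : Fin P.d) : shiftN x μ 1 = x.shift μ := rfl

/-- Rows compose: `rowProd U x μ (m + n) = rowProd U x μ m · rowProd U (x + m e_μ) μ n`. [cite: Balaban1985Averaging, (9) p.19] -/
theorem rowProd_add (U : GaugeField P j G) (x : Site P j) (μ : Fin P.d) (m : ℕ) :
    ∀ n : ℕ, rowProd U x μ (m + n) = rowProd U x μ m * rowProd U (shiftN x μ m) μ n
  | 0 => by rw [add_zero, rowProd_zero, mul_one]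
  | n + 1 => by rw [← add_assoc, rowProd_succ, rowProd_add U x μ m n, rowProd_succ, shiftN_add, mul_assoc]

/-- A shift by `r` steps of `e_κ` is the translate by `r e_κ`. [folklore] -/
theorem shiftN_eq_transl (x : Site P j) (κ : Fin P.d) (r : ℕ) : shiftN x κ r = transl x (fun ι => if ι = κ then (r : ℤ) else 0) := by
  funext ι
  rw [BlockAveragingEMLProp2.shiftN_apply, transl_apply]
  by_cases h : ι = κ
  · simp [h]
  · simp [h]

/-- The end of a straight run: `walkEnd x (axisRun a k) = x + k e_a`. [cite: Balaban1987RG1, (0.3) p.252] -/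
theorem walkEnd_axisRun (x : Site P j) (a : Fin P.d) (k : ℤ) : walkEnd x (axisRun a k) = transl x (fun ι => if ι = a then k else 0) := by
  rw [walkEnd_eq_transl]
  congr 1; funext ι
  rw [netDisp_axisRun]
  by_cases h : ι = a
  · simp [h]
  · simp [h, Ne.symm h]

/-- The end of a staircase over DISTINCT axes: `walkEnd x (stairRuns n as) = x + Σ_{a ∈ as} n_a e_a`. [cite: Balaban1987RG1, (0.3) p.252] -/
theorem walkEnd_stairRuns (x : Site P j) (n : Fin P.d → ℤ) {as : List (Fin P.d)} (has : as.Nodup) :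
    walkEnd x (stairRuns n as) = transl x (fun ι => if ι ∈ as then n ι else 0) := by
  rw [walkEnd_eq_transl]
  congr 1; funext ι
  rw [netDisp_stairRuns n as has]

end Words

/-! ## §2 The comb-fan Stokes bound in SUM currency -/

section Fan

variable {P : Params} {j : ℕ} {G : Type*} [GaugeGroup G]

/-- **PEELING THE FIRST LEG** off the diagonal staircase loop of ✓`dist1_stairLoop_le_sum_rect` ((b3) §3, whose induction step this is, isolated): the loop over
`a :: as` from `x` costs at most the loop over `as` from the first corner `x₁ = x + n_a e_a` plus the `N × |n_a|` rectangle of the first leg (based at its LOWER corner).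
[cite: Balaban1985Averaging, (9) p.19, (19)-(20) p.21; Balaban1987RG1, (0.3) p.252] -/
theorem dist1_stairLoop_cons_le (U : GaugeField P j G) (μ : Fin P.d) (N : ℕ) (n : Fin P.d → ℤ) (a : Fin P.d) (as : List (Fin P.d))
    (x : Site P j) :
    dist1 (holAt U (walk x (stairRuns n (a :: as))) * rowProd U (walkEnd x (stairRuns n (a :: as))) μ N *
        (holAt U (walk (shiftN x μ N) (stairRuns n (a :: as))))⁻¹ * (rowProd U x μ N)⁻¹) ≤
      dist1 (holAt U (walk (walkEnd x (axisRun a (n a))) (stairRuns n as)) *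
          rowProd U (walkEnd (walkEnd x (axisRun a (n a))) (stairRuns n as)) μ N *
          (holAt U (walk (shiftN (walkEnd x (axisRun a (n a))) μ N) (stairRuns n as)))⁻¹ *
          (rowProd U (walkEnd x (axisRun a (n a))) μ N)⁻¹) +
        dist1 (rect U (if 0 ≤ n a then x else walkEnd x (axisRun a (n a))) μ a N (n a).natAbs) := by
  have hsr : stairRuns n (a :: as) = axisRun a (n a) ++ stairRuns n as := rfl
  set x₁ := walkEnd x (axisRun a (n a)) with hx₁
  have hnear : holAt U (walk x (stairRuns n (a :: as))) = holAt U (walk x (axisRun a (n a))) * holAt U (walk x₁ (stairRuns n as)) := by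
    rw [hsr, walk_append, holAt_append]
  have hend : walkEnd x (stairRuns n (a :: as)) = walkEnd x₁ (stairRuns n as) := by rw [hsr, walkEnd_append]
  have hfar : holAt U (walk (shiftN x μ N) (stairRuns n (a :: as))) =
      holAt U (walk (shiftN x μ N) (axisRun a (n a))) * holAt U (walk (shiftN x₁ μ N) (stairRuns n as)) := by
    rw [hsr, walk_append, holAt_append, walkEnd_shiftN]
  set hA := holAt U (walk x (axisRun a (n a))) with hhA
  set hA' := holAt U (walk (shiftN x μ N) (axisRun a (n a))) with hhA'
  set hR := holAt U (walk x₁ (stairRuns n as)) with hhR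
  set hR' := holAt U (walk (shiftN x₁ μ N) (stairRuns n as)) with hhR'
  have e : hA * hR * rowProd U (walkEnd x₁ (stairRuns n as)) μ N * (hA' * hR')⁻¹ * (rowProd U x μ N)⁻¹ =
      hA * (hR * rowProd U (walkEnd x₁ (stairRuns n as)) μ N * hR'⁻¹ * (rowProd U x₁ μ N)⁻¹) * hA⁻¹ *
        (hA * rowProd U x₁ μ N * hA'⁻¹ * (rowProd U x μ N)⁻¹) := by
    group
  rw [hnear, hend, hfar, e]
  refine (GaugeGroup.dist1_mul_le _ _).trans ?_
  rw [GaugeGroup.dist1_conj]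
  refine add_le_add le_rfl (le_of_eq ?_)
  rcases le_or_gt 0 (n a) with hk | hk
  · obtain ⟨h1, h2⟩ := holAt_walk_axisRun_of_nonneg U x a hk
    obtain ⟨h1', -⟩ := holAt_walk_axisRun_of_nonneg U (shiftN x μ N) a hk
    rw [if_pos hk, hhA, hhA', h1, h1', hx₁, h2]
    exact dist1_oneLeg_fwd U x μ a N (n a).natAbs
  · obtain ⟨h1, h2⟩ := holAt_walk_axisRun_of_neg U x a hk
    obtain ⟨-, h2'⟩ := holAt_walk_axisRun_of_neg U (shiftN x μ N) a hk
    rw [if_neg (not_le.mpr hk), hhA, hhA', h2, h2', walkEnd_shiftN, ← hx₁]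
    conv_lhs => rw [← h1, ← hx₁]
    exact dist1_oneLeg_bwd U x₁ μ a N (n a).natAbs

/-- ★ **DIAGONAL STAIRCASE STOKES WITH A PLAQUETTE-SLOT FAMILY** (sum currency, any gauge group): for distinct axes `as ∌ μ` there is a family of base sites
`site κ r` (`κ ∈ as`, `r < |n_κ|`), each a translate `x + w` with `|w_ι| ≤ |n_ι|` on the listed axes and `w_ι = 0` elsewhere, such that FOR EVERY configuration
the diagonal staircase loop (staircase from `x`, row of `N` steps `+e_μ`, translated staircase back, row back) is within
`Σ_{κ ∈ as} Σ_{r < |n_κ|} Σ_{s < N} dist1 U(∂p(site κ r + s e_μ; μ, κ))` of `1` — one plaquette per slot, `N·Σ_κ|n_κ|` slots; the family does not depend on `U`.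
[cite: Balaban1985Averaging, (9) p.19, (19)-(20) p.21; Balaban1987RG1, (0.3) p.252] -/
theorem exists_sites_stairLoop_le (μ : Fin P.d) (N : ℕ) (n : Fin P.d → ℤ) :
    ∀ (as : List (Fin P.d)), as.Nodup → μ ∉ as → ∀ x : Site P j, ∃ site : Fin P.d → ℕ → Site P j,
      (∀ κ ∈ as, ∀ r < (n κ).natAbs, ∃ w : Fin P.d → ℤ, site κ r = transl x w ∧
          ∀ ι, (w ι).natAbs ≤ if ι ∈ as then (n ι).natAbs else 0) ∧
      ∀ U : GaugeField P j G,
        dist1 (holAt U (walk x (stairRuns n as)) * rowProd U (walkEnd x (stairRuns n as)) μ N *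
            (holAt U (walk (shiftN x μ N) (stairRuns n as)))⁻¹ * (rowProd U x μ N)⁻¹) ≤
          ∑ κ ∈ as.toFinset, ∑ r ∈ range (n κ).natAbs, ∑ s ∈ range N, dist1 (rect U (shiftN (site κ r) μ s) μ κ 1 1)
  | [], _, _, x => by
    refine ⟨fun _ _ => x, fun κ hκ => by simp at hκ, fun U => ?_⟩
    simp [stairRuns, walk, walkEnd, holAt_nil, GaugeGroup.dist1_one]
  | a :: as, hnd, hμ, x => by
    have ha : a ∉ as := (List.nodup_cons.mp hnd).1
    have has : as.Nodup := (List.nodup_cons.mp hnd).2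
    have hμa : μ ≠ a := fun h => hμ (h ▸ List.mem_cons_self)
    have hμas : μ ∉ as := fun h => hμ (List.mem_cons_of_mem a h)
    set x₁ := walkEnd x (axisRun a (n a)) with hx₁
    obtain ⟨site₀, hloc₀, hbd₀⟩ := exists_sites_stairLoop_le μ N n as has hμas x₁
    set corner : Site P j := if 0 ≤ n a then x else x₁ with hcorner
    refine ⟨fun κ r => if κ = a then shiftN corner a r else site₀ κ r, ?_, fun U => ?_⟩
    · -- locality
      intro κ hκ r hr
      dsimp only
      by_cases hκa : κ = a
      · subst hκa
        rw [if_pos rfl]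
        rcases le_or_gt 0 (n κ) with hk | hk
        · rw [hcorner, if_pos hk, shiftN_eq_transl]
          refine ⟨_, rfl, fun ι => ?_⟩
          by_cases hι : ι = κ
          · subst hι; simp; omega
          · simp [hι]
        · rw [hcorner, if_neg (not_le.mpr hk), hx₁, walkEnd_axisRun, shiftN_eq_transl, ← transl_add]
          refine ⟨_, rfl, fun ι => ?_⟩
          by_cases hι : ι = κ
          · subst hι; simp; omega
          · simp [hι]
      · rw [if_neg hκa]
        have hκ' : κ ∈ as := by simpa [hκa] using hκ
        obtain ⟨w, hw, hwb⟩ := hloc₀ κ hκ' r hr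
        rw [hw, hx₁, walkEnd_axisRun, ← transl_add]
        refine ⟨_, rfl, fun ι => ?_⟩
        have hι := hwb ι
        by_cases hιa : ι = a
        · subst hιa
          rw [if_neg ha] at hι
          simp; omega
        · simpa [hιa] using hι
    · -- the bound: peel the first leg, Stokes on its rectangle, induction on the rest
      refine (dist1_stairLoop_cons_le U μ N n a as x).trans ?_
      dsimp only
      rw [List.toFinset_cons, sum_insert (fun h => ha (List.mem_toFinset.mp h)), add_comm]
      refine add_le_add ?_ ?_
      · simp only [if_true]
        exact dist1_rect_le_unoriented U corner hμa N (n a).natAbs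
      · refine (hbd₀ U).trans (le_of_eq (sum_congr rfl fun κ hκ => ?_))
        have hκa : κ ≠ a := fun h => ha (h ▸ List.mem_toFinset.mp hκ)
        simp only [if_neg hκa]

/-- **THE COMB LOOP IS CONJUGATE TO THE FAN LOOP**: with the processing order `(d−1, …, 0) = s ++ μ :: t` of the comb, the loop
`Γ_{y,y+v} ∪ [y+v, y+v+e_μ] ∪ (−Γ_{y,y+v+e_μ})` of ✓`dist1_holAt_combLoop_le` has the same `dist1` as the diagonal staircase loop over the LATER axes `t` with row
length `1`, based at the end `z` of the `μ`-segment (the two combs share the earlier segments and the `μ`-segment up to one step, §1's one-step lemma).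
[cite: Balaban1985Averaging, pp.24-25; Balaban1985RegularSpaces, (1.19) p.79] -/
theorem dist1_combLoop_eq_fanLoop (U : GaugeField P j G) (y : Site P j) (v : Fin P.d → ℤ) (μ : Fin P.d) {s t : List (Fin P.d)}
    (hst : (List.finRange P.d).reverse = s ++ μ :: t) (hμs : μ ∉ s) (hμt : μ ∉ t) :
    dist1 (holAt U (walk y (treeWord v ++ [(μ, true)] ++ wordRev (treeWord (v + e μ))))) =
      dist1 (holAt U (walk (walkEnd y (stairRuns v s ++ seg μ (v μ))) (stairRuns v t)) *
        rowProd U (walkEnd (walkEnd y (stairRuns v s ++ seg μ (v μ))) (stairRuns v t)) μ 1 *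
        (holAt U (walk (shiftN (walkEnd y (stairRuns v s ++ seg μ (v μ))) μ 1) (stairRuns v t)))⁻¹ *
        (rowProd U (walkEnd y (stairRuns v s ++ seg μ (v μ))) μ 1)⁻¹) := by
  have hv' : ∀ a, a ≠ μ → (v + e μ) a = v a := fun a ha => by simp [e_apply, ha]
  have hvμ : (v + e μ) μ = v μ + 1 := by simp [e_apply]
  have h1 : treeWord v = (stairRuns v s ++ seg μ (v μ)) ++ stairRuns v t := by
    rw [treeWord_eq_stairRuns, hst, T4Continuum.stairRuns_append, stairRuns, seg_eq_axisRun, List.append_assoc]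
  have h2 : treeWord (v + e μ) = (stairRuns v s ++ seg μ (v μ + 1)) ++ stairRuns v t := by
    rw [treeWord_eq_stairRuns, hst, T4Continuum.stairRuns_append, stairRuns, seg_eq_axisRun, hvμ,
      stairRuns_congr (fun a ha => hv' a (fun h => hμs (h ▸ ha))),
      stairRuns_congr (fun a ha => hv' a (fun h => hμt (h ▸ ha))), List.append_assoc]
  -- the two comb transports
  have hT1 : holAt U (walk y (treeWord v)) =
      holAt U (walk y (stairRuns v s ++ seg μ (v μ))) * holAt U (walk (walkEnd y (stairRuns v s ++ seg μ (v μ))) (stairRuns v t)) := by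
    rw [h1, walk_append, holAt_append]
  obtain ⟨hstep, hstepEnd⟩ := holAt_walk_seg_succ U (walkEnd y (stairRuns v s)) μ (v μ)
  have hpreHol : holAt U (walk y (stairRuns v s ++ seg μ (v μ + 1))) =
      holAt U (walk y (stairRuns v s ++ seg μ (v μ))) * U ⟨walkEnd y (stairRuns v s ++ seg μ (v μ)), μ⟩ := by
    rw [walk_append, holAt_append, hstep, walk_append, holAt_append, walkEnd_append, mul_assoc]
  have hpreEnd : walkEnd y (stairRuns v s ++ seg μ (v μ + 1)) = (walkEnd y (stairRuns v s ++ seg μ (v μ))).shift μ := by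
    rw [walkEnd_append, hstepEnd, walkEnd_append]
  have hT2 : holAt U (walk y (treeWord (v + e μ))) = holAt U (walk y (stairRuns v s ++ seg μ (v μ))) *
      U ⟨walkEnd y (stairRuns v s ++ seg μ (v μ)), μ⟩ *
      holAt U (walk ((walkEnd y (stairRuns v s ++ seg μ (v μ))).shift μ) (stairRuns v t)) := by
    rw [h2, walk_append, holAt_append, hpreHol, hpreEnd]
  -- ends
  have hx : walkEnd y (treeWord v) = walkEnd (walkEnd y (stairRuns v s ++ seg μ (v μ))) (stairRuns v t) := by
    rw [h1, walkEnd_append]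
  have hend : walkEnd y (treeWord v ++ [(μ, true)]) = walkEnd y (treeWord (v + e μ)) := by
    rw [walkEnd_append, walkEnd_treeWord, walkEnd_treeWord, transl_add_e]; rfl
  -- assemble
  have hr1 : ∀ x' : Site P j, rowProd U x' μ 1 = U ⟨x', μ⟩ := fun x' => by simp [rowProd]
  rw [walk_append, holAt_append, hend, holAt_walk_wordRev, walk_append, holAt_append, hx, holAt_walk_single_true, hT1, hT2,
    hr1, hr1, shiftN_one]
  set g := holAt U (walk y (stairRuns v s ++ seg μ (v μ)))
  set z := walkEnd y (stairRuns v s ++ seg μ (v μ))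
  have e' : g * holAt U (walk z (stairRuns v t)) * U ⟨walkEnd z (stairRuns v t), μ⟩ *
        (g * U ⟨z, μ⟩ * holAt U (walk (z.shift μ) (stairRuns v t)))⁻¹ =
      g * (holAt U (walk z (stairRuns v t)) * U ⟨walkEnd z (stairRuns v t), μ⟩ * (holAt U (walk (z.shift μ) (stairRuns v t)))⁻¹ *
        (U ⟨z, μ⟩)⁻¹) * g⁻¹ := by
    group
  rw [e', GaugeGroup.dist1_conj]

/-- ★★ **THE COMB-FAN STOKES BOUND IN SUM CURRENCY** (drop-in for the sup edition ✓`Prop7AxialGaugeSup.dist1_holAt_combLoop_le`, same left side): for every base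
site `y`, offset `v` and direction `μ` there is a `U`-INDEPENDENT family of plaquette base sites `site κ r` (`κ ≠ μ`, `r < |v_κ|`; each `= y + w` with
`|w_ι| ≤ |v_ι|` for all `ι` — inside the box spanned by the comb) such that for EVERY configuration `U`
`dist1 𝒰_y(Γ_{y,y+v} ∪ [y+v, y+v+e_μ] ∪ (−Γ_{y,y+v+e_μ})) ≤ Σ_{κ ≠ μ} Σ_{r < |v_κ|} dist1 U(∂p(site κ r; μ, κ))` — at most `|v|₁` plaquettes (the axes processed
before `μ` contribute nothing; their slots are listed with harmless extra nonnegative terms so that the index set is `v`-shaped).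
[cite: Balaban1985Averaging, pp.24-25, (19)-(20) p.21; Balaban1985RegularSpaces, Lemma 1 p.79] -/
theorem exists_sites_combLoop_le (y : Site P j) (v : Fin P.d → ℤ) (μ : Fin P.d) :
    ∃ site : Fin P.d → ℕ → Site P j,
      (∀ κ, κ ≠ μ → ∀ r < (v κ).natAbs, ∃ w : Fin P.d → ℤ, site κ r = transl y w ∧ ∀ ι, (w ι).natAbs ≤ (v ι).natAbs) ∧
      ∀ U : GaugeField P j G, dist1 (holAt U (walk y (treeWord v ++ [(μ, true)] ++ wordRev (treeWord (v + e μ))))) ≤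
        ∑ κ ∈ univ.erase μ, ∑ r ∈ range (v κ).natAbs, dist1 (rect U (site κ r) μ κ 1 1) := by
  classical
  obtain ⟨s, t, hst, hμs, hμt, hs, ht, hdis⟩ := exists_split_axes μ
  set z := walkEnd y (stairRuns v s ++ seg μ (v μ)) with hz
  obtain ⟨site₀, hloc₀, hbd₀⟩ := exists_sites_stairLoop_le (G := G) μ 1 v t ht hμt z
  have hzw : z = transl y (fun ι => (if ι ∈ s then v ι else 0) + (if ι = μ then v μ else 0)) := by
    rw [hz, walkEnd_append, walkEnd_stairRuns y v hs, seg_eq_axisRun, walkEnd_axisRun, ← transl_add]; rfl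
  refine ⟨fun κ r => if κ ∈ t then site₀ κ r else y, fun κ hκμ r hr => ?_, fun U => ?_⟩
  · dsimp only
    by_cases hκt : κ ∈ t
    · rw [if_pos hκt]
      obtain ⟨w, hw, hwb⟩ := hloc₀ κ hκt r hr
      rw [hw, hzw, ← transl_add]
      refine ⟨_, rfl, fun ι => ?_⟩
      have hι := hwb ι
      by_cases hιt : ι ∈ t
      · have hιs : ι ∉ s := fun h => hdis ι h hιt
        have hιμ : ι ≠ μ := fun h => hμt (h ▸ hιt)
        rw [if_pos hιt] at hι
        simp only [Pi.add_apply, if_neg hιs, if_neg hιμ, zero_add]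
        exact hι
      · rw [if_neg hιt] at hι
        have hw0 : w ι = 0 := by omega
        by_cases hιs : ι ∈ s
        · have hιμ : ι ≠ μ := fun h => hμs (h ▸ hιs)
          simp [hιs, hιμ, hw0]
        · by_cases hιμ : ι = μ
          · subst hιμ; simp [hιs, hw0]
          · simp [hιs, hιμ, hw0]
    · rw [if_neg hκt]
      exact ⟨0, (transl_zero y).symm, fun ι => by simp⟩
  · dsimp only
    rw [dist1_combLoop_eq_fanLoop U y v μ hst hμs hμt, ← hz]
    refine (hbd₀ U).trans ?_
    have hsub : t.toFinset ⊆ univ.erase μ := fun κ hκ =>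
      mem_erase.mpr ⟨fun h => hμt (h ▸ List.mem_toFinset.mp hκ), mem_univ _⟩
    refine le_trans (le_of_eq (sum_congr rfl fun κ hκ => sum_congr rfl fun r _ => ?_))
      (sum_le_sum_of_subset_of_nonneg hsub fun κ _ _ => sum_nonneg fun r _ => GaugeGroup.dist1_nonneg _)
    rw [sum_range_one, shiftN_zero, if_pos (List.mem_toFinset.mp hκ)]

end Fan

end Summit.QuantumFields.YangMills.Theorems.FluctuationComparisonRegPrIntLS2BetaStaircaseSlotStokes
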